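import Literature.LinearAlgebra.Matrix.PfaffianTransvection

/-!
# The Pfaffian of an alternating matrix, IV: Cayley's theorem `det A = (pf A)²`

For every alternating matrix `A` (`Aᵀ = -A`, zero diagonal) over ANY commutative ring,
`det A = (pfaffian A)²` (`det_eq_pfaffian_sq`); in particular the determinant of an alternating
matrix is a square (`isSquare_det_of_transpose_eq_neg`, any finite index type) and vanishes in odd
size (`det_eq_zero_of_transpose_eq_neg_of_odd`).  Cayley, *Sur les déterminants gauches* (1849);
Goodman–Wallach, *Symmetry, Representations, and Invariants*, Corollary B.2.9; stated over a
commutative (Noetherian) ring by Kustin–Ulrich, Mem. AMS 461 §1 p. 9 ("The pfaffian of X, pf(X),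
is an element of R whose square is the determinant of X").

## Proof (Goodman–Wallach Lemma B.2.8 / Corollary B.2.9, made division-free by a generic matrix)

By two-step induction on the size.  For size `n + 2` it suffices (both sides being integer
polynomials in the entries, `pfaffian_map`, `RingHom.map_det`) to treat the GENERIC alternating
matrix `X = (x_{ij})` over `P = ℤ[x_{ij} : i < j]` (`genericAlt`), and by injectivity of
`P → K = Frac P` to treat `X` over the field `K`, where every `x_{0j}` (`j ≥ 1`) is invertible.
There the skew Cholesky step of Goodman–Wallach Lemma B.2.8 applies in the adjacent-transvection
form of `PfaffianTransvection.lean`: successively adding `-x_{0,m}/x_{0,m-1}` times row/column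
`m-1` to row/column `m` (`m = n+1, …, 2`) kills the first row beyond its `(0,1)` entry without
changing `det` (`det_transvection_of_ne`) or `pf` (`pfaffian_transvection_mul_mul_transpose`)
(`exists_reduced_fst_row`, proved there).  For such a reduced alternating `B`, two Laplace
expansions give
`det B = B₀₁² · det B'` and the definition gives `pf B = B₀₁ · pf B'` with `B'` the minor deleting
`{0, 1}` (`det_eq_sq_mul_det_pfMinor_zero`, `pfaffian_eq_mul_pfaffian_pfMinor_zero`); the induction
hypothesis for `B'` (over `K`) closes the step.

## Application recorded for the lattice-QCD venture (why this file was written)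

With C* boundary conditions the one-flavour fermion path integral is a Pfaffian,
`∫ Dψ̄ Dψ e^{-ψ̄ D ψ} = Pf (C D_J)` with `C D_J` antisymmetric, and `(Pf C D_J)² = Det D_J`
(Lucini–Patella–Ramos–Tantalo, JHEP 02 (2016) 076, Appendix "Anatomy of the sign problem"); the
algebraic identity used there is `det_eq_pfaffian_sq`. [LuciniEtAl2015]

## References

* A. Cayley, *Sur les déterminants gauches*, J. reine angew. Math. **38** (1849) 93–96. [Cayley1849]
* R. Goodman, N. R. Wallach, *Symmetry, Representations, and Invariants*, GTM 255 (2009),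
  App. B.2.6, Lemma B.2.8 and Corollary B.2.9; App. B.2.7 Lemma B.2.10. [GoodmanWallachGTM255]
* A. R. Kustin, B. Ulrich, Mem. Amer. Math. Soc. **95** (1992) no. 461, §1 p. 9. [KustinUlrich1992]
* B. Lucini, A. Patella, A. Ramos, N. Tantalo, JHEP **02** (2016) 076, Appendix A. [LuciniEtAl2015]
-/

namespace Literature.LinearAlgebra.Matrix

open Finset
open _root_.Matrix

variable {R : Type*} [CommRing R]

/-! ## Reduced matrices: first row concentrated in the `(0,1)` entry -/

/-- If the first row of an alternating `(n+2) × (n+2)` matrix vanishes beyond its `(0,1)` entry,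
two Laplace expansions (row `0`, then column `0`) give `det A = A₀₁² · det (A minus crosses 0, 1)`.
[folklore] -/
private theorem det_eq_sq_mul_det_pfMinor_zero {n : ℕ} (A : Matrix (Fin (n + 2)) (Fin (n + 2)) R)
    (hA : Aᵀ = -A) (hd : ∀ i, A i i = 0) (h0 : ∀ j : Fin (n + 2), 2 ≤ (j : ℕ) → A 0 j = 0) :
    A.det = A 0 1 ^ 2 * (pfMinor A 0).det := by
  have halt : ∀ x y, A y x = -A x y := fun x y => by
    simpa using congrFun (congrFun hA x) y
  rw [det_succ_row_zero, Fin.sum_univ_succ, Fin.sum_univ_succ, hd 0]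
  have hrest : ∑ j : Fin n, (-1) ^ ((j.succ.succ : Fin (n + 2)) : ℕ) * A 0 j.succ.succ *
      (A.submatrix Fin.succ j.succ.succ.succAbove).det = 0 := by
    refine Finset.sum_eq_zero fun j _ => ?_
    rw [h0 _ (by simp), mul_zero, zero_mul]
  rw [hrest, add_zero, mul_zero, zero_mul, zero_add]
  -- the remaining minor `M` (rows 1.., columns ≠ 1): expand along column 0
  set M : Matrix (Fin (n + 1)) (Fin (n + 1)) R := A.submatrix Fin.succ (Fin.succ 0).succAbove
    with hM
  have hM0 : ∀ i : Fin (n + 1), M i 0 = A i.succ 0 := fun i => by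
    rw [hM, submatrix_apply, Fin.succAbove_ne_zero_zero (Fin.succ_ne_zero 0)]
  rw [det_succ_column_zero M, Fin.sum_univ_succ]
  have hrest' : ∑ i : Fin n, (-1) ^ ((i.succ : Fin (n + 1)) : ℕ) * M i.succ 0 *
      (M.submatrix i.succ.succAbove Fin.succ).det = 0 := by
    refine Finset.sum_eq_zero fun i _ => ?_
    rw [hM0, halt, h0 _ (by simp), neg_zero, mul_zero, zero_mul]
  rw [hrest', add_zero, hM0, halt 0 (Fin.succ 0)]
  have hsub : M.submatrix (0 : Fin (n + 1)).succAbove Fin.succ = pfMinor A 0 := by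
    ext a b
    simp only [hM, submatrix_apply, pfMinor_apply, Fin.succ_succAbove_succ, Fin.succAbove_zero]
  rw [hsub]
  simp only [Fin.succ_zero_eq_one, Fin.val_one, Fin.val_zero, pow_zero, pow_one, one_mul]
  ring

/-- If the first row of an `(n+2) × (n+2)` matrix vanishes beyond its `(0,1)` entry, the defining
expansion gives `pf A = A₀₁ · pf (A minus crosses 0, 1)` (Goodman–Wallach (B.16) for
`z₁J ⊕ B`). [cite: GoodmanWallachGTM255, App. B.2.6 (B.16)] -/
private theorem pfaffian_eq_mul_pfaffian_pfMinor_zero {n : ℕ}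
    (A : Matrix (Fin (n + 2)) (Fin (n + 2)) R) (h0 : ∀ j : Fin (n + 2), 2 ≤ (j : ℕ) → A 0 j = 0) :
    pfaffian A = A 0 1 * pfaffian (pfMinor A 0) := by
  rw [pfaffian_fin_add_two, Fin.sum_univ_succ]
  have hrest : ∑ j : Fin n, (-1) ^ ((j.succ : Fin (n + 1)) : ℕ) * A 0 j.succ.succ *
      pfaffian (pfMinor A j.succ) = 0 := by
    refine Finset.sum_eq_zero fun j _ => ?_
    rw [h0 _ (by simp), mul_zero, zero_mul]
  rw [hrest, add_zero]
  simp

/-! ## The generic alternating matrix -/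

/-- The generic alternating `m × m` matrix `X` over `ℤ[x_{ij}]`: `X i j = x_{ij}` for `i < j`,
`-x_{ji}` for `j < i`, `0` on the diagonal (the variables are indexed by all pairs; only those with
`i < j` are used), as in Goodman–Wallach B.2.7.
[cite: GoodmanWallachGTM255, App. B.2.7 Lemma B.2.10(3)] -/
noncomputable def genericAlt (m : ℕ) :
    Matrix (Fin m) (Fin m) (MvPolynomial (Fin m × Fin m) ℤ) :=
  fun i j => if i < j then MvPolynomial.X (i, j) else if j < i then -MvPolynomial.X (j, i) else 0

/-- Entries of `genericAlt`. [folklore] -/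
private theorem genericAlt_apply (m : ℕ) (i j : Fin m) :
    genericAlt m i j =
      if i < j then MvPolynomial.X (i, j) else if j < i then -MvPolynomial.X (j, i) else 0 := rfl

/-- `genericAlt` is alternating. [folklore] -/
private theorem genericAlt_transpose (m : ℕ) : (genericAlt m)ᵀ = -genericAlt m := by
  ext i j
  rw [transpose_apply, Matrix.neg_apply, genericAlt_apply, genericAlt_apply]
  by_cases h1 : i < j
  · simp [h1, lt_asymm h1]
  · by_cases h2 : j < i
    · simp [h1, h2]
    · simp [h1, h2]

/-- `genericAlt` has zero diagonal. [folklore] -/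
private theorem genericAlt_apply_self (m : ℕ) (i : Fin m) : genericAlt m i i = 0 := by
  simp [genericAlt_apply]

/-- Every alternating matrix is a specialisation of the generic one:
`X.map (x_{ij} ↦ A i j) = A`. [folklore] -/
private theorem genericAlt_map_eval {m : ℕ} (A : Matrix (Fin m) (Fin m) R) (hA : Aᵀ = -A)
    (hd : ∀ i, A i i = 0) :
    (genericAlt m).map (MvPolynomial.eval₂Hom (Int.castRingHom R) fun p => A p.1 p.2) = A := by
  have halt : ∀ x y, A y x = -A x y := fun x y => by
    simpa using congrFun (congrFun hA x) y
  ext i j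
  rw [map_apply, genericAlt_apply]
  by_cases h1 : i < j
  · simp [h1]
  · by_cases h2 : j < i
    · simp [h1, h2, halt j i]
    · have hij : i = j := le_antisymm (not_lt.mp h2) (not_lt.mp h1)
      simp [hij, hd j]

/-! ## Cayley's theorem -/

/-- The minors `pfMinor B j` of an alternating matrix are alternating. [folklore] -/
private theorem transpose_pfMinor {S : Type*} [CommRing S] {n : ℕ}
    (B : Matrix (Fin (n + 2)) (Fin (n + 2)) S) (hB : Bᵀ = -B) (j : Fin (n + 1)) :
    (pfMinor B j)ᵀ = -pfMinor B j := by
  rw [pfMinor, transpose_submatrix, hB]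
  rfl

/-- Cayley's theorem for rings in `Type` (the induction runs through the fraction field of the
generic coefficient ring, which lives in `Type`); see `det_eq_pfaffian_sq`.
[cite: Cayley1849, pp. 93–96] -/
private theorem det_eq_pfaffian_sq_aux :
    ∀ (n : ℕ) {S : Type} [CommRing S] (A : Matrix (Fin n) (Fin n) S),
      Aᵀ = -A → (∀ i, A i i = 0) → A.det = pfaffian A ^ 2
  | 0, S, _, A, _, _ => by simp
  | 1, S, _, A, _, hd => by simp [hd]
  | n + 2, S, _, A, hA, hd => by
      -- (a) reduce to the generic matrix over `P = ℤ[x]`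
      suffices hX : (genericAlt (n + 2)).det = pfaffian (genericAlt (n + 2)) ^ 2 by
        have h := congrArg (MvPolynomial.eval₂Hom (Int.castRingHom S) fun p => A p.1 p.2) hX
        rw [RingHom.map_det, RingHom.mapMatrix_apply, map_pow, ← pfaffian_map,
          genericAlt_map_eval A hA hd] at h
        exact h
      -- (b) pass to the fraction field `K`
      let P := MvPolynomial (Fin (n + 2) × Fin (n + 2)) ℤ
      let K := FractionRing P
      apply IsFractionRing.injective P K
      rw [RingHom.map_det, RingHom.mapMatrix_apply, map_pow, ← pfaffian_map]
      set B : Matrix (Fin (n + 2)) (Fin (n + 2)) K := (genericAlt (n + 2)).map (algebraMap P K)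
        with hB
      have hBT : Bᵀ = -B := by
        ext i j
        have h := congrFun (congrFun (genericAlt_transpose (n + 2)) i) j
        rw [transpose_apply, Matrix.neg_apply] at h
        rw [transpose_apply, Matrix.neg_apply, hB, map_apply, map_apply, h, map_neg]
      have hBd : ∀ i, B i i = 0 := fun i => by
        rw [hB, map_apply, genericAlt_apply_self, map_zero]
      have hB0 : ∀ j : Fin (n + 2), 1 ≤ (j : ℕ) → (j : ℕ) ≤ n + 1 → B 0 j ≠ 0 := by
        intro j hj _
        have h0j : (0 : Fin (n + 2)) < j := by
          rw [Fin.lt_def]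
          exact hj
        rw [hB, map_apply, genericAlt_apply, if_pos h0j]
        exact fun h => MvPolynomial.X_ne_zero _
          ((IsFractionRing.injective P K) (by rw [h, map_zero]))
      -- (c) skew Cholesky reduction of the first row, then the two expansions and induction
      obtain ⟨B', hB'T, hB'd, hdet, hpf, hzero⟩ :=
        exists_reduced_fst_row n B hBT hBd hB0 (fun j hj => by have := j.isLt; omega)
      rw [← hdet, ← hpf, det_eq_sq_mul_det_pfMinor_zero B' hB'T hB'd hzero,
        pfaffian_eq_mul_pfaffian_pfMinor_zero B' hzero,
        det_eq_pfaffian_sq_aux n (pfMinor B' 0) (transpose_pfMinor B' hB'T 0)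
          (fun i => hB'd _)]
      ring

/-- **Cayley's theorem: the determinant of an alternating matrix is the square of its Pfaffian.**
For every commutative ring `R` and every `A : Matrix (Fin n) (Fin n) R` with `Aᵀ = -A` and zero
diagonal, `det A = (pf A)²` (for odd `n` both sides vanish).  Cayley (1849); Goodman–Wallach
Corollary B.2.9 ("If `A ∈ M_{2n}` is skew-symmetric then `(Pfaff(A))² = det A`"); over a
commutative ring, Kustin–Ulrich §1 p. 9.  The zero-diagonal hypothesis is needed in
characteristic `2` (e.g. the `2 × 2` identity over `𝔽₂`). This is the identity
`(Pf C D_J)² = Det D_J` behind the Pfaffian representation of the C*-boundary fermion determinant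
in lattice QCD (Lucini–Patella–Ramos–Tantalo 2016, App. A).
[cite: Cayley1849, pp. 93–96; GoodmanWallachGTM255, Corollary B.2.9] -/
theorem det_eq_pfaffian_sq {n : ℕ} (A : Matrix (Fin n) (Fin n) R) (hA : Aᵀ = -A)
    (hd : ∀ i, A i i = 0) : A.det = pfaffian A ^ 2 := by
  have hX := det_eq_pfaffian_sq_aux n (genericAlt n) (genericAlt_transpose n)
    (genericAlt_apply_self n)
  have h := congrArg (MvPolynomial.eval₂Hom (Int.castRingHom R) fun p => A p.1 p.2) hX
  rw [RingHom.map_det, RingHom.mapMatrix_apply, map_pow, ← pfaffian_map,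
    genericAlt_map_eval A hA hd] at h
  exact h

/-- **The determinant of an alternating matrix of odd size vanishes** (over any commutative ring,
with the zero-diagonal hypothesis; Cayley 1849, Kustin–Ulrich §1 p. 9 "The pfaffian of X is zero
if g is odd"). [cite: Cayley1849, pp. 93–96; KustinUlrich1992, §1 p. 9] -/
theorem det_eq_zero_of_transpose_eq_neg_of_odd {n : ℕ} (hn : Odd n) (A : Matrix (Fin n) (Fin n) R)
    (hA : Aᵀ = -A) (hd : ∀ i, A i i = 0) : A.det = 0 := by
  rw [det_eq_pfaffian_sq A hA hd, pfaffian_eq_zero_of_odd A hn, zero_pow two_ne_zero]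

/-- **The determinant of an alternating matrix is a square** — for any finite index type: choose
an ordering and apply `det_eq_pfaffian_sq`.
[cite: Cayley1849, pp. 93–96; GoodmanWallachGTM255, Corollary B.2.9] -/
theorem isSquare_det_of_transpose_eq_neg {ι : Type*} [Fintype ι] [DecidableEq ι]
    (A : Matrix ι ι R) (hA : Aᵀ = -A) (hd : ∀ i, A i i = 0) : IsSquare A.det := by
  let e := (Fintype.equivFin ι).symm
  have hsub : (A.submatrix e e)ᵀ = -A.submatrix e e := by
    rw [transpose_submatrix, hA, submatrix_neg]
    rfl
  refine ⟨pfaffian (A.submatrix e e), ?_⟩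
  rw [← det_submatrix_equiv_self e A, det_eq_pfaffian_sq _ hsub fun i => hd _, sq]

end Literature.LinearAlgebra.Matrix
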